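/-
NEXT RUNG beyond LRAD for crux item stmt-PneNP-18538 (`StrongComposition`, C1) — planner-pnp-ideate-p4, gen 20.
SUPERSEDES `NextRungP4g19.lean` (37bbaeaf): the support notion `SubspaceHard` is REPAIRED (satisfiability
guard, referee SCORE 369), the stubs `LRBQuantitative` / `LRXQuantitative` and the support statement
`jointSubspaceHard_exists` (S0⁺) are restated over it, and small kernel sanity lemmas are added.
DEFINITIONS, STATEMENTS AND SANITY LEMMAS ONLY (no stubs, no sorry).  FRONTIER work; nothing here bears on `P ≠ NP`.
-/
import Mathlib
import Summits.PneNP.PneNP.Theses.KrwChromaticSteering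
import Literature.Computability.Complexity.KRWComposition

/-!
# Beyond LRAD, v2: `SubspaceHard` guarded; the classes `LRAD ⊆ LRB ⊆ LRX_t`; stubs restated

What changed relative to `NextRungP4g19.lean` (g19, referee SCORE 369 GAP-STATED):

* `SubspaceHard g q` now carries the SATISFIABILITY GUARD `(∃ x, ∀ e ∈ F, rowParity e.1 x = e.2) →`, exactly as
  `AffGeneric` does.  Without it the unsatisfiable system `F = [(∅, true)]` empties both slices, the depth-`0`
  leaf solves the empty rectangle and `¬ SubspaceHard g q` for every `g` once `q ≥ 2` (ref's kernel probe
  `subspaceHard_false_of_two_le`).  With it that system is harmless (`guard_emptyTrue` below), the notion has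
  content (`hard_of_subspaceHard`, `nonconst_of_subspaceHard`), and it is exactly what the (L2) move of memo
  `LensBarrierP4g19.md` §6.0 uses: the internal equations of the PATH's system, which are satisfiable by the
  invariant (`Sat E` holds at the assignment in hand).  Toy census (in-seat, seconds, `kit/subspacehard_n4.py`
  in p4 g20's folder, table in memo `LensBarrierP4g20.md` §1): on `n = 4`, 30 952 of the 65 536 functions have
  `SubspaceHard g 2` (e.g. `Thr₂⁴`, `IP₂ = x₀x₁ ⊕ x₂x₃`, `MAJ`-type `wt ≥ 3`); on `n = 3` none does (some
  hyperplane restriction is always one-sided or decided by a single leaf).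
* (v3, late g20) section `NodeCount`: the node-count class `LRXN_T` and `LRXNodeQuantitative` (memo §3.6(b) typed;
  `LRX_t ⊆ LRXN_t` and `LRXNodeQuantitative → LRXQuantitative` kernel-checked; not registered).
* `LRBQuantitative` / `LRXQuantitative` are restated over the guarded notion, with an EXISTENTIAL additive
  constant `C` (LRAD's proof gives `2`; typing checklist (iv)), and WITHOUT the hypothesis
  `PerRowLU g m q` of g19: it is derivable from `AffGeneric g r`, `q + r + 1 ≤ n` by the PROVED S3
  (`P4g19.perRowLUOfGeneric_holds`, kernel commit c8d411a66445; being landed by the custody lead under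
  `Theorems/KrwChromaticSteeringStrongCompositionLrad*.lean`), so dropping it leaves the stubs' strength unchanged
  and makes the skeleton's composition S3-free (crux workfiles are not importable between world builds).
* NEW kernel lemmas (cheap, all proved): `lrxOn_zero_of_lradOn` / `lrb_of_lrad` — every LRAD-disciplined tree is
  LRB-disciplined (so `StrongCompositionLRB → StrongCompositionLRAD`: the new rung sits ABOVE the proved one);
  `lrxOn_mono` (budget monotonicity, `LRB = LRX_0 ⊆ LRX_t`); `lrb_of_strongComposition`,
  `lrx_of_strongComposition` (both rungs are implied by C1 verbatim); the `SubspaceHard` sanity lemmas.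

Unchanged from g19 (verbatim): the typing-with-loads `RowTypeX`, `affWeight`, `retagX`, `NodeOKX`,
`LRXDisciplinedOn`, `LRBDisciplined := LRXDisciplined g 0`, the rungs `StrongCompositionLRB` / `StrongCompositionLRX`.
Diagnosis recalled (memo v6 §6.0, sharpened in `LensBarrierP4g20.md`): LRB = LRAD + type-B nodes (a single-row test
on an ALGEBRAIC row), conjecturally free for the gluing invariant via (L1) equation splitting at the row boundary +
(L2) the internal-to-row-set move (`S_i = T_i = V_i`, row game `Hard ≥ q − λ` by the guarded `SubspaceHard`,
`K ↦ min K k`); type-A nodes (an affine test through a COMBINATORIAL row) cost one extra unit per combinatorial row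
touched (`LRX_t`, loss `+ t`), and the class with teeth stays LRA (unbounded type-A weight).
DEFINITIONS, STATEMENTS AND SANITY LEMMAS ONLY.  FRONTIER work; nothing here bears on `P ≠ NP`.
-/

set_option linter.dupNamespace false
set_option autoImplicit false

namespace Summit.PneNP.PneNP.Cruxes.StrongComposition.P4g20X

open Literature.Computability.Complexity

universe u

/-! ## §0 Vocabulary (verbatim from the landed `Theorems.KrwLrad` / the g19 kernel file) -/

section Vocabulary

variable {ι : Type u} {m n : ℕ}

/-- [verbatim `KrwLrad.SolvesRect`] the tree `Q` solves the KW game on the rectangle `A × B`. -/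
def SolvesRect (Q : KWTree ι) (A B : Set (ι → Bool)) : Prop :=
  ∀ a ∈ A, ∀ b ∈ B, a (Q.run a b) ≠ b (Q.run a b)

/-- [verbatim `KrwLrad.Hard`] every tree solving `A × B` has depth `≥ ℓ`. -/
def Hard (A B : Set (ι → Bool)) (ℓ : ℕ) : Prop :=
  ∀ Q : KWTree ι, SolvesRect Q A B → ℓ ≤ Q.depth

/-- [verbatim `KrwLrad.parityOn`] parity of the entries of `X` on a support `S ⊆ [m] × [n]`. -/
def parityOn (S : Finset (Fin m × Fin n)) (X : Fin m × Fin n → Bool) : Bool :=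
  Nat.bodd (S.filter fun p => X p = true).card

/-- [verbatim `KrwLrad.IsLabelTest`] a function of the own label vector only. -/
def IsLabelTest (g : (Fin n → Bool) → Bool) (s : (Fin m × Fin n → Bool) → Bool) : Prop :=
  ∃ φ : (Fin m → Bool) → Bool, ∀ X, s X = φ (rowLabels g X)

/-- [verbatim `KrwLrad.rowParity`] parity of a row vector on `S ⊆ [n]`. -/
def rowParity (S : Finset (Fin n)) (x : Fin n → Bool) : Bool := Nat.bodd (S.filter fun j => x j = true).card

/-- [verbatim `KrwLrad.AffGeneric`] `r`-affine-genericity of `g` by equations. -/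
def AffGeneric (g : (Fin n → Bool) → Bool) (r : ℕ) : Prop :=
  ∀ E : List (Finset (Fin n) × Bool), E.length + r + 1 ≤ n →
    (∃ x, ∀ e ∈ E, rowParity e.1 x = e.2) → ∀ β : Bool, ∃ x, (∀ e ∈ E, rowParity e.1 x = e.2) ∧ g x = β

/-- [verbatim `KrwLrad.eqRows`] the rows an equation support touches. -/
def eqRows (S : Finset (Fin m × Fin n)) : Finset (Fin m) := S.image Prod.fst

/-- [verbatim `KrwLrad.RowType`] LRAD's online row types. -/
inductive RowType
  | fresh
  | algebraic
  | combinatorial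
  deriving DecidableEq

/-- [verbatim `KrwLrad.touchedRows`] -/
def touchedRows (S : Finset (Fin m × Fin n)) : Finset (Fin m) := S.image Prod.fst

/-- [verbatim `KrwLrad.retag`] -/
def retag (S : Finset (Fin m × Fin n)) (τ : Fin m → RowType) : Fin m → RowType :=
  fun i => if i ∈ touchedRows S then RowType.algebraic else τ i

/-- [verbatim `KrwLrad.NodeOK`] one node of LRAD at typing `τ`. -/
def NodeOK (g : (Fin n → Bool) → Bool) (τ : Fin m → RowType) (s : (Fin m × Fin n → Bool) → Bool)
    (τ' : Fin m → RowType) : Prop :=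
  (IsLabelTest g s ∧ τ' = τ) ∨
  (∃ (S : Finset (Fin m × Fin n)) (c : Bool), (∀ X, s X = Bool.xor c (parityOn S X)) ∧
      (∀ i ∈ touchedRows S, τ i ≠ .combinatorial) ∧ τ' = retag S τ) ∨
  (∃ (i : Fin m) (ψ : (Fin n → Bool) → Bool), (∀ X, s X = ψ (row X i)) ∧ τ i ≠ .algebraic ∧
      τ' = Function.update τ i .combinatorial)

/-- [verbatim `KrwLrad.LRADisciplinedOn`] -/
def LRADisciplinedOn (g : (Fin n → Bool) → Bool) : (Fin m → RowType) → KWTree (Fin m × Fin n) → Prop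
  | _, .leaf _ => True
  | τ, .alice s P Q => ∃ τ', NodeOK g τ s τ' ∧ LRADisciplinedOn g τ' P ∧ LRADisciplinedOn g τ' Q
  | τ, .bob s P Q => ∃ τ', NodeOK g τ s τ' ∧ LRADisciplinedOn g τ' P ∧ LRADisciplinedOn g τ' Q

/-- [verbatim `KrwLrad.LRADisciplined`] -/
def LRADisciplined (g : (Fin n → Bool) → Bool) (P : KWTree (Fin m × Fin n)) : Prop :=
  LRADisciplinedOn g (fun _ => RowType.fresh) P

/-- [verbatim `KrwLrad.StrongCompositionLRAD`] the PROVED rung (workfile `Lines/lrad_gluing.lean` v3). -/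
def StrongCompositionLRAD : Prop :=
  ∃ c : ℕ, ∀ m n : ℕ, 1 ≤ n → ∀ f : (Fin m → Bool) → Bool, (∃ a b, f a ≠ f b) →
    ∃ g : (Fin n → Bool) → Bool, ∀ P : KWTree (Fin m × Fin n), LRADisciplined g P → P.SolvesStrong f g →
      ∃ Q : KWTree (Fin m), Q.Solves f ∧ Q.depth + n ≤ P.depth + c * (Nat.log 2 (m * n) + 1)

/-- **SUPPORT NOTION S0⁺, REPAIRED (g20).** `g` is *subspace-hard with budget `q`*: on every SATISFIABLE system
`F` of `λ ≤ q` parity equations, the Karchmer–Wigderson game of `g` restricted to `V = {x | F x}` (answers =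
ambient coordinates) has depth `≥ q − λ`.  The guard `(∃ x, …) →` is the g19 → g20 repair (SCORE 369): an
unsatisfiable `F` constrains nothing.  `λ = 0`: `D_KW(g) ≥ q` (`hard_of_subspaceHard`); `q ≥ 1` forces `g`
non-constant (`nonconst_of_subspaceHard`).  By counting, a uniformly random `g` has it for `q = n − O(log n)`
jointly with `AffGeneric` (`jointSubspaceHard_exists`): a protocol of depth `d` for `g|_V` is a De Morgan formula
of size `≤ 2^d` over the ambient literals computing a TOTAL function that agrees with `g` on `V`, so for fixed `V`
(`|V| ≥ 2^{n−λ}`) at most `#formulas(2^d) · 2^{2^n − 2^{n−λ}}` functions are bad; with `d = q − λ − 1`,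
`q = n − c (log₂ n + 1) − 1`, `c ≥ 3`, the union over the `≤ 2^{(n+1) q}` satisfiable systems stays below
`2^{2^n − 1}` because `2^{n−λ} ≥ 2 n^c ≫ (n + 1) q + 2^{q−λ−1} log₂ (16 n)`. -/
def SubspaceHard (g : (Fin n → Bool) → Bool) (q : ℕ) : Prop :=
  ∀ F : List (Finset (Fin n) × Bool), F.length ≤ q → (∃ x, ∀ e ∈ F, rowParity e.1 x = e.2) →
    Hard {x | (∀ e ∈ F, rowParity e.1 x = e.2) ∧ g x = true}
         {x | (∀ e ∈ F, rowParity e.1 x = e.2) ∧ g x = false} (q - F.length)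

/-- **S0⁺ (support, counting; the analogue of the PROVED `P4g19.jointHardGeneric_exists`), restated over the
guarded notion.**  Template: `exists_affBad` (affine genericity, g19 §6) plus one more union bound over the
`≤ 2^{(n+1)q}` satisfiable systems with the Riordan–Shannon count `card_easy_le_card_code`. Size ≈ 400 lines. -/
def jointSubspaceHard_exists : Prop :=
  ∃ c : ℕ, ∀ n : ℕ, c * (Nat.log 2 n + 1) + 1 ≤ n →
    ∃ g : (Fin n → Bool) → Bool,
      AffGeneric g (c * (Nat.log 2 n + 1)) ∧ SubspaceHard g (n - c * (Nat.log 2 n + 1) - 1)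

end Vocabulary

/-! ## §1 The classes `LRB ⊆ LRX_t` (verbatim g19) -/

section Crossing

variable {m n : ℕ}

/-- [verbatim `P4g19X.RowTypeX`] Row types WITH LOADS. -/
inductive RowTypeX
  | fresh
  | algebraic (load : ℕ)
  | combinatorial
  deriving DecidableEq

/-- [verbatim `P4g19X.RowTypeX.load`] -/
def RowTypeX.load : RowTypeX → ℕ
  | .algebraic l => l
  | _ => 0

/-- [verbatim `P4g19X.affWeight`] crossing weight of an affine support: the combinatorial rows it touches. -/
def affWeight (U : Finset (Fin m × Fin n)) (τ : Fin m → RowTypeX) : ℕ :=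
  ((eqRows U).filter fun i => τ i = RowTypeX.combinatorial).card

/-- [verbatim `P4g19X.retagX`] -/
def retagX (U : Finset (Fin m × Fin n)) (τ : Fin m → RowTypeX) : Fin m → RowTypeX :=
  fun i => if i ∈ eqRows U then
    (if τ i = RowTypeX.combinatorial then RowTypeX.combinatorial else RowTypeX.algebraic ((τ i).load + 1))
    else τ i

/-- [verbatim `P4g19X.NodeOKX`] one node of `LRX`: a label test (weight `0`), an affine test (weight = number of
combinatorial rows its support touches), or a single-row test on ANY row (weight `0`; the row becomes
combinatorial — type B is allowed). -/
def NodeOKX (g : (Fin n → Bool) → Bool) (τ : Fin m → RowTypeX) (s : (Fin m × Fin n → Bool) → Bool)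
    (τ' : Fin m → RowTypeX) (w : ℕ) : Prop :=
  (IsLabelTest g s ∧ τ' = τ ∧ w = 0) ∨
  (∃ (U : Finset (Fin m × Fin n)) (c : Bool), (∀ X, s X = Bool.xor c (parityOn U X)) ∧
      τ' = retagX U τ ∧ w = affWeight U τ) ∨
  (∃ (i : Fin m) (ψ : (Fin n → Bool) → Bool), (∀ X, s X = ψ (row X i)) ∧
      τ' = Function.update τ i RowTypeX.combinatorial ∧ w = 0)

/-- [verbatim `P4g19X.LRXDisciplinedOn`] class `LRX_t` from a typing: total crossing weight `≤ t` on every path. -/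
def LRXDisciplinedOn (g : (Fin n → Bool) → Bool) :
    ℕ → (Fin m → RowTypeX) → KWTree (Fin m × Fin n) → Prop
  | _, _, .leaf _ => True
  | t, τ, .alice s P Q => ∃ (τ' : Fin m → RowTypeX) (w : ℕ), NodeOKX g τ s τ' w ∧ w ≤ t ∧
      LRXDisciplinedOn g (t - w) τ' P ∧ LRXDisciplinedOn g (t - w) τ' Q
  | t, τ, .bob s P Q => ∃ (τ' : Fin m → RowTypeX) (w : ℕ), NodeOKX g τ s τ' w ∧ w ≤ t ∧
      LRXDisciplinedOn g (t - w) τ' P ∧ LRXDisciplinedOn g (t - w) τ' Q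

/-- [verbatim `P4g19X.LRXDisciplined`] -/
def LRXDisciplined (g : (Fin n → Bool) → Bool) (t : ℕ) (P : KWTree (Fin m × Fin n)) : Prop :=
  LRXDisciplinedOn g t (fun _ => RowTypeX.fresh) P

/-- [verbatim `P4g19X.LRBDisciplined`] **class LRB** `= LRX_0`: equations first, single-row tests after, per
row; never an equation through a row already cut by a single-row test. -/
def LRBDisciplined (g : (Fin n → Bool) → Bool) (P : KWTree (Fin m × Fin n)) : Prop := LRXDisciplined g 0 P

end Crossing

/-! ## §2 The rungs and the candidate stubs (restated over the guarded notion) -/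

/-- [verbatim `P4g19X.StrongCompositionLRB`] **Rung C1|LRB**: strong composition with C1's own loss for every
LRB protocol.  (Unaffected by the repair: it does not mention `SubspaceHard`.) -/
def StrongCompositionLRB : Prop :=
  ∃ c : ℕ, ∀ m n : ℕ, 1 ≤ n → ∀ f : (Fin m → Bool) → Bool, (∃ a b, f a ≠ f b) →
    ∃ g : (Fin n → Bool) → Bool, ∀ P : KWTree (Fin m × Fin n),
      LRBDisciplined g P → P.SolvesStrong f g →
      ∃ Q : KWTree (Fin m), Q.Solves f ∧ Q.depth + n ≤ P.depth + c * (Nat.log 2 (m * n) + 1)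

/-- [verbatim `P4g19X.StrongCompositionLRX`] **Rung C1|LRX**: loss `c (log₂(m n) + 1) + t` on `LRX_t`. -/
def StrongCompositionLRX : Prop :=
  ∃ c : ℕ, ∀ m n : ℕ, 1 ≤ n → ∀ f : (Fin m → Bool) → Bool, (∃ a b, f a ≠ f b) →
    ∃ g : (Fin n → Bool) → Bool, ∀ (t : ℕ) (P : KWTree (Fin m × Fin n)),
      LRXDisciplined g t P → P.SolvesStrong f g →
      ∃ Q : KWTree (Fin m), Q.Solves f ∧ Q.depth + n ≤ P.depth + c * (Nat.log 2 (m * n) + 1) + t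

/-- **Stub `LRBQuantitative` (g20 restatement).**  Every LRB protocol for the strong game of a non-constant `f`
(label rectangle of hardness `ℓ`) against an `r`-affinely-generic `g` that is subspace-hard with budget `q`,
`q + r + 1 ≤ n`, has depth `≥ ℓ + (q − 1) − C` for an absolute constant `C` (the LRAD proof gives `C = 2`; the
constant is existential on purpose — typing checklist (iv): an off-by-one at a type-B boundary must not be a
refutation of the line, and the rung's composition absorbs any `C`).  Shape of the PROVED `LRADQuantitative` (lead's
`KrwLrad.LRADQuantitative`, loss `ℓ + min dg (q − 1) ≤ depth + 2`) with the class widened LRAD ↦ LRB, the KW-depth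
hypothesis `dg` replaced by `SubspaceHard g q` (which contains it at `λ = 0`), and `PerRowLU g m q` dropped (S3).
What the LRAD invariant lacks for it (memo §6.0 / g20 memo §2): (L1) equation SPLITTING at a row boundary (per-row
loads preserved; a COMMON internal parity `γ` for both players exists because either `Sat E` forces it or both
values are satisfiable), (L2) the internal-to-row-set MOVE (`S_i = T_i = V_i`; `AE` unchanged by `AffGeneric`;
row game `Hard ≥ q − λ > k_i ≥ K` by `SubspaceHard`; `K ↦ min K k` free), (L3) loads in the typing. -/
def LRBQuantitative : Prop :=
  ∃ C : ℕ, ∀ (m n q r ℓ : ℕ) (f : (Fin m → Bool) → Bool) (g : (Fin n → Bool) → Bool),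
    (∃ a b, f a = true ∧ f b = false) →
    AffGeneric g r → q + r + 1 ≤ n → SubspaceHard g q → 1 ≤ q →
    Hard (f ⁻¹' {true}) (f ⁻¹' {false}) ℓ →
    ∀ P : KWTree (Fin m × Fin n), LRBDisciplined g P → P.SolvesStrong f g →
      ℓ + (q - 1) ≤ P.depth + C

/-- **Stub `LRXQuantitative` (g20 restatement)**: the type-A allowance `t` (one extra unit per combinatorial row
an affine test touches; (L4) = the decoupling step, an M3 row step with an affine `ψ` then an LRAD affine step). -/
def LRXQuantitative : Prop :=
  ∃ C : ℕ, ∀ (m n q r ℓ t : ℕ) (f : (Fin m → Bool) → Bool) (g : (Fin n → Bool) → Bool),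
    (∃ a b, f a = true ∧ f b = false) →
    AffGeneric g r → q + r + 1 ≤ n → SubspaceHard g q → 1 ≤ q →
    Hard (f ⁻¹' {true}) (f ⁻¹' {false}) ℓ →
    ∀ P : KWTree (Fin m × Fin n), LRXDisciplined g t P → P.SolvesStrong f g →
      ℓ + (q - 1) ≤ P.depth + C + t

/-! ## §3 Sanity lemmas (kernel-checked; cheap) -/

section Sanity

variable {m n : ℕ}

/-- The degenerate system of SCORE 369 is unsatisfiable, so the guarded clause says nothing about it. -/
theorem not_sat_emptyTrue : ¬ ∃ x : Fin n → Bool, ∀ e ∈ [((∅ : Finset (Fin n)), true)], rowParity e.1 x = e.2 := by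
  rintro ⟨x, hx⟩
  have := hx (∅, true) (by simp)
  simp [rowParity] at this

/-- The guarded clause of `SubspaceHard` is vacuous on every unsatisfiable system (the repair in one line). -/
theorem guard_of_unsat (g : (Fin n → Bool) → Bool) (q : ℕ) (F : List (Finset (Fin n) × Bool))
    (hF : ¬ ∃ x : Fin n → Bool, ∀ e ∈ F, rowParity e.1 x = e.2) :
    F.length ≤ q → (∃ x, ∀ e ∈ F, rowParity e.1 x = e.2) →
      Hard {x | (∀ e ∈ F, rowParity e.1 x = e.2) ∧ g x = true}
           {x | (∀ e ∈ F, rowParity e.1 x = e.2) ∧ g x = false} (q - F.length) :=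
  fun _ hsat => absurd hsat hF

/-- `λ = 0`: a subspace-hard `g` is Karchmer–Wigderson-hard with the full budget (the notion has content). -/
theorem hard_of_subspaceHard {g : (Fin n → Bool) → Bool} {q : ℕ} (h : SubspaceHard g q) :
    Hard {x | g x = true} {x | g x = false} q := by
  have := h [] (by simp) ⟨fun _ => false, by simp⟩
  simpa using this

/-- KW-hardness in the tree's `Solves` form. -/
theorem depth_le_of_subspaceHard {g : (Fin n → Bool) → Bool} {q : ℕ} (h : SubspaceHard g q)
    (R : KWTree (Fin n)) (hR : R.Solves g) : q ≤ R.depth :=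
  hard_of_subspaceHard h R fun a ha b hb => hR a b ha hb

/-- `q ≥ 1` (and `n ≥ 1`, so that a leaf exists): a subspace-hard `g` is non-constant. -/
theorem nonconst_of_subspaceHard {g : (Fin n → Bool) → Bool} {q : ℕ} (h : SubspaceHard g q) (hq : 1 ≤ q)
    (hn : 1 ≤ n) : ∃ u v, g u = true ∧ g v = false := by
  have hH := hard_of_subspaceHard h
  by_contra hne
  push Not at hne
  have hsolves : SolvesRect (KWTree.leaf (⟨0, hn⟩ : Fin n)) {x | g x = true} {x | g x = false} := by
    intro a ha b hb
    exact absurd hb (by simpa using hne a b ha)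
  have := hH _ hsolves
  simp at this
  omega

/-- Compatible typings (LRAD without loads vs. LRX with loads): the same combinatorial rows. -/
def Compat (τ : Fin m → RowType) (σ : Fin m → RowTypeX) : Prop :=
  ∀ i, τ i = RowType.combinatorial ↔ σ i = RowTypeX.combinatorial

theorem affWeight_eq_zero {U : Finset (Fin m × Fin n)} {σ : Fin m → RowTypeX}
    (h : ∀ i ∈ eqRows U, σ i ≠ RowTypeX.combinatorial) : affWeight U σ = 0 := by
  unfold affWeight
  rw [Finset.card_eq_zero, Finset.filter_eq_empty_iff]
  exact fun i hi => h i hi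

/-- An LRAD-legal node is an LRX-legal node of weight `0`, compatibly. -/
theorem nodeOKX_of_nodeOK {g : (Fin n → Bool) → Bool} {τ τ' : Fin m → RowType} {σ : Fin m → RowTypeX}
    {s : (Fin m × Fin n → Bool) → Bool} (hc : Compat τ σ) (h : NodeOK g τ s τ') :
    ∃ σ', NodeOKX g σ s σ' 0 ∧ Compat τ' σ' := by
  rcases h with ⟨hl, rfl⟩ | ⟨S, c, hs, htouch, rfl⟩ | ⟨i, ψ, hs, _, rfl⟩
  · exact ⟨σ, Or.inl ⟨hl, rfl, rfl⟩, hc⟩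
  · have hσ : ∀ i ∈ eqRows S, σ i ≠ RowTypeX.combinatorial :=
      fun i hi hi' => htouch i hi ((hc i).2 hi')
    refine ⟨retagX S σ, Or.inr (Or.inl ⟨S, c, hs, rfl, (affWeight_eq_zero hσ).symm⟩), fun i => ?_⟩
    by_cases hi : i ∈ eqRows S
    · have h1 : retag S τ i = RowType.algebraic := if_pos hi
      have h2 : retagX S σ i ≠ RowTypeX.combinatorial := by
        simp only [retagX, if_pos hi, if_neg (hσ i hi)]
        exact fun h => RowTypeX.noConfusion h
      rw [h1]
      exact ⟨fun h => RowType.noConfusion h, fun h => absurd h h2⟩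
    · have h1 : retag S τ i = τ i := if_neg hi
      have h2 : retagX S σ i = σ i := if_neg hi
      rw [h1, h2]
      exact hc i
  · refine ⟨Function.update σ i RowTypeX.combinatorial, Or.inr (Or.inr ⟨i, ψ, hs, rfl, rfl⟩), fun i' => ?_⟩
    by_cases hi : i' = i
    · subst hi; simp
    · rw [Function.update_of_ne hi, Function.update_of_ne hi]; exact hc i'

/-- **LRAD ⊆ LRB, tree by tree**: a tree disciplined for LRAD from `τ` is `LRX_0`-disciplined from any
compatible typing with loads. -/
theorem lrxOn_zero_of_lradOn (g : (Fin n → Bool) → Bool) :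
    ∀ (P : KWTree (Fin m × Fin n)) (τ : Fin m → RowType) (σ : Fin m → RowTypeX),
      Compat τ σ → LRADisciplinedOn g τ P → LRXDisciplinedOn g 0 σ P
  | .leaf _, _, _, _, _ => trivial
  | .alice s P Q, τ, σ, hc, h => by
    obtain ⟨τ', hnode, hP, hQ⟩ := h
    obtain ⟨σ', hnode', hc'⟩ := nodeOKX_of_nodeOK hc hnode
    exact ⟨σ', 0, hnode', le_rfl, lrxOn_zero_of_lradOn g P τ' σ' hc' hP,
      lrxOn_zero_of_lradOn g Q τ' σ' hc' hQ⟩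
  | .bob s P Q, τ, σ, hc, h => by
    obtain ⟨τ', hnode, hP, hQ⟩ := h
    obtain ⟨σ', hnode', hc'⟩ := nodeOKX_of_nodeOK hc hnode
    exact ⟨σ', 0, hnode', le_rfl, lrxOn_zero_of_lradOn g P τ' σ' hc' hP,
      lrxOn_zero_of_lradOn g Q τ' σ' hc' hQ⟩

/-- **LRAD ⊆ LRB.** -/
theorem lrb_of_lrad {g : (Fin n → Bool) → Bool} {P : KWTree (Fin m × Fin n)} (h : LRADisciplined g P) :
    LRBDisciplined g P :=
  lrxOn_zero_of_lradOn g P _ _ (fun _ => ⟨fun h => RowType.noConfusion h, fun h => RowTypeX.noConfusion h⟩) h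

/-- Budget monotonicity: `LRX_t ⊆ LRX_{t'}` for `t ≤ t'`. -/
theorem lrxOn_mono (g : (Fin n → Bool) → Bool) :
    ∀ (P : KWTree (Fin m × Fin n)) (t t' : ℕ) (σ : Fin m → RowTypeX), t ≤ t' →
      LRXDisciplinedOn g t σ P → LRXDisciplinedOn g t' σ P
  | .leaf _, _, _, _, _, _ => trivial
  | .alice s P Q, t, t', σ, htt, h => by
    obtain ⟨σ', w, hnode, hw, hP, hQ⟩ := h
    exact ⟨σ', w, hnode, hw.trans htt, lrxOn_mono g P _ _ σ' (by omega) hP, lrxOn_mono g Q _ _ σ' (by omega) hQ⟩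
  | .bob s P Q, t, t', σ, htt, h => by
    obtain ⟨σ', w, hnode, hw, hP, hQ⟩ := h
    exact ⟨σ', w, hnode, hw.trans htt, lrxOn_mono g P _ _ σ' (by omega) hP, lrxOn_mono g Q _ _ σ' (by omega) hQ⟩

/-- **The new rung sits above the proved one**: C1|LRB implies C1|LRAD. -/
theorem strongCompositionLRAD_of_LRB (h : StrongCompositionLRB) : StrongCompositionLRAD := by
  obtain ⟨c, hc⟩ := h
  refine ⟨c, fun m n hn f hf => ?_⟩
  obtain ⟨g, hg⟩ := hc m n hn f hf
  exact ⟨g, fun P hP hsol => hg P (lrb_of_lrad hP) hsol⟩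

/-- C1|LRX implies C1|LRB (`t = 0`). -/
theorem strongCompositionLRB_of_LRX (h : StrongCompositionLRX) : StrongCompositionLRB := by
  obtain ⟨c, hc⟩ := h
  refine ⟨c, fun m n hn f hf => ?_⟩
  obtain ⟨g, hg⟩ := hc m n hn f hf
  exact ⟨g, fun P hP hsol => by simpa using hg 0 P hP hsol⟩

/-- Both rungs are implied by C1 verbatim (a refutation of either refutes C1). -/
theorem lrb_of_strongComposition (h : Theses.KrwChromaticSteering.StrongComposition) : StrongCompositionLRB := by
  obtain ⟨c, hc⟩ := h
  refine ⟨c, fun m n hn f hf => ?_⟩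
  obtain ⟨g, hg⟩ := hc m n hn f hf
  exact ⟨g, fun P _ hP => hg P hP⟩

theorem lrx_of_strongComposition (h : Theses.KrwChromaticSteering.StrongComposition) : StrongCompositionLRX := by
  obtain ⟨c, hc⟩ := h
  refine ⟨c, fun m n hn f hf => ?_⟩
  obtain ⟨g, hg⟩ := hc m n hn f hf
  refine ⟨g, fun t P _ hP => ?_⟩
  obtain ⟨Q, hQ, hd⟩ := hg P hP
  exact ⟨Q, hQ, by omega⟩

/-- `LRXQuantitative` at `t = 0` is `LRBQuantitative`. -/
theorem lrbQuantitative_of_lrx (h : LRXQuantitative) : LRBQuantitative := by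
  obtain ⟨C, hC⟩ := h
  exact ⟨C, fun m n q r ℓ f g hf hgen hqr hsub hq hH P hP hsol => by
    simpa using hC m n q r ℓ 0 f g hf hgen hqr hsub hq hH P hP hsol⟩

end Sanity

/-! ## Node-count budget (memo `LensBarrierP4g20.md` §3.6(b), typed)

With opposite-sides routing a type-A node costs the eager adversary at most ONE unit beyond the bit paid (the
«decoupling tax»), independently of its crossing weight.  So the budget that matters is the NUMBER of type-A nodes on
a path, not their total weight: `LRXN_T` = at most `T` affine tests through combinatorial rows on every path (any
weights).  `LRX_t ⊆ LRXN_t` (a path of total weight `t` has at most `t` type-A nodes), so `LRXNodeQuantitative` below is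
STRONGER than `LRXQuantitative`; it is the typed form of §3.6(b) and is NOT registered (no third skeleton this
generation).  Why it might fail: the routing argument restricts every alive label class of every crossed row to its
good side in parallel (one unit on `min K`), then reads the node as «label parity ⊕ external affine» (one label step
and/or one common affine step); an error in the claim that no label class is emptied (rows with credit `≤ 1`) would
surface as a larger constant `C`, an error in the parallel accounting as a genuine failure. -/
section NodeCount

variable {m n : ℕ}

/-- One node of `LRXN`: as `NodeOKX` but an affine test weighs `1` if it meets at least one combinatorial row and `0`
otherwise (node count instead of crossing weight). -/
def NodeOKXN (g : (Fin n → Bool) → Bool) (τ : Fin m → RowTypeX) (s : (Fin m × Fin n → Bool) → Bool)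
    (τ' : Fin m → RowTypeX) (w : ℕ) : Prop :=
  (IsLabelTest g s ∧ τ' = τ ∧ w = 0) ∨
  (∃ (U : Finset (Fin m × Fin n)) (c : Bool), (∀ X, s X = Bool.xor c (parityOn U X)) ∧
      τ' = retagX U τ ∧ w = min (affWeight U τ) 1) ∨
  (∃ (i : Fin m) (ψ : (Fin n → Bool) → Bool), (∀ X, s X = ψ (row X i)) ∧
      τ' = Function.update τ i RowTypeX.combinatorial ∧ w = 0)

/-- `LRXN` discipline with node budget `T` below typing `τ`. -/
def LRXNDisciplinedOn (g : (Fin n → Bool) → Bool) :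
    ℕ → (Fin m → RowTypeX) → KWTree (Fin m × Fin n) → Prop
  | _, _, .leaf _ => True
  | T, τ, .alice s P Q => ∃ (τ' : Fin m → RowTypeX) (w : ℕ), NodeOKXN g τ s τ' w ∧ w ≤ T ∧
      LRXNDisciplinedOn g (T - w) τ' P ∧ LRXNDisciplinedOn g (T - w) τ' Q
  | T, τ, .bob s P Q => ∃ (τ' : Fin m → RowTypeX) (w : ℕ), NodeOKXN g τ s τ' w ∧ w ≤ T ∧
      LRXNDisciplinedOn g (T - w) τ' P ∧ LRXNDisciplinedOn g (T - w) τ' Q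

/-- `P ∈ LRXN_T`: at most `T` type-A NODES on every path, all rows initially fresh. -/
def LRXNDisciplined (g : (Fin n → Bool) → Bool) (T : ℕ) (P : KWTree (Fin m × Fin n)) : Prop :=
  LRXNDisciplinedOn g T (fun _ => RowTypeX.fresh) P

/-- **Node-count adversary bound** (§3.6(b); NOT a registered stub): loss `C + T` with `T` the node budget. -/
def LRXNodeQuantitative : Prop :=
  ∃ C : ℕ, ∀ (m n q r ℓ T : ℕ) (f : (Fin m → Bool) → Bool) (g : (Fin n → Bool) → Bool),
    (∃ a b, f a = true ∧ f b = false) →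
    AffGeneric g r → q + r + 1 ≤ n → SubspaceHard g q → 1 ≤ q →
    Hard (f ⁻¹' {true}) (f ⁻¹' {false}) ℓ →
    ∀ P : KWTree (Fin m × Fin n), LRXNDisciplined g T P → P.SolvesStrong f g →
      ℓ + (q - 1) ≤ P.depth + C + T

theorem nodeOKXN_of_nodeOKX {g : (Fin n → Bool) → Bool} {τ τ' : Fin m → RowTypeX}
    {s : (Fin m × Fin n → Bool) → Bool} {w : ℕ} (h : NodeOKX g τ s τ' w) :
    ∃ w', w' ≤ w ∧ NodeOKXN g τ s τ' w' := by
  rcases h with ⟨hl, hτ, hw⟩ | ⟨U, c, hs, hτ, hw⟩ | ⟨i, ψ, hs, hτ, hw⟩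
  · exact ⟨0, by omega, Or.inl ⟨hl, hτ, rfl⟩⟩
  · exact ⟨min (affWeight U τ) 1, by rw [hw]; exact Nat.min_le_left _ _, Or.inr (Or.inl ⟨U, c, hs, hτ, rfl⟩)⟩
  · exact ⟨0, by omega, Or.inr (Or.inr ⟨i, ψ, hs, hτ, rfl⟩)⟩

theorem lrxnOn_mono (g : (Fin n → Bool) → Bool) :
    ∀ (P : KWTree (Fin m × Fin n)) (T T' : ℕ) (σ : Fin m → RowTypeX), T ≤ T' →
      LRXNDisciplinedOn g T σ P → LRXNDisciplinedOn g T' σ P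
  | .leaf _, _, _, _, _, _ => trivial
  | .alice s P Q, T, T', σ, hTT, h => by
    obtain ⟨σ', w, hnode, hw, hP, hQ⟩ := h
    exact ⟨σ', w, hnode, hw.trans hTT, lrxnOn_mono g P _ _ σ' (by omega) hP, lrxnOn_mono g Q _ _ σ' (by omega) hQ⟩
  | .bob s P Q, T, T', σ, hTT, h => by
    obtain ⟨σ', w, hnode, hw, hP, hQ⟩ := h
    exact ⟨σ', w, hnode, hw.trans hTT, lrxnOn_mono g P _ _ σ' (by omega) hP, lrxnOn_mono g Q _ _ σ' (by omega) hQ⟩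

/-- **`LRX_t ⊆ LRXN_t`** below any typing: the node count of a path is at most its total crossing weight. -/
theorem lrxnOn_of_lrxOn (g : (Fin n → Bool) → Bool) :
    ∀ (P : KWTree (Fin m × Fin n)) (t : ℕ) (σ : Fin m → RowTypeX),
      LRXDisciplinedOn g t σ P → LRXNDisciplinedOn g t σ P
  | .leaf _, _, _, _ => trivial
  | .alice s P Q, t, σ, h => by
    obtain ⟨σ', w, hnode, hw, hP, hQ⟩ := h
    obtain ⟨w', hw', hnode'⟩ := nodeOKXN_of_nodeOKX hnode
    exact ⟨σ', w', hnode', by omega,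
      lrxnOn_mono g P _ _ σ' (by omega) (lrxnOn_of_lrxOn g P _ σ' hP),
      lrxnOn_mono g Q _ _ σ' (by omega) (lrxnOn_of_lrxOn g Q _ σ' hQ)⟩
  | .bob s P Q, t, σ, h => by
    obtain ⟨σ', w, hnode, hw, hP, hQ⟩ := h
    obtain ⟨w', hw', hnode'⟩ := nodeOKXN_of_nodeOKX hnode
    exact ⟨σ', w', hnode', by omega,
      lrxnOn_mono g P _ _ σ' (by omega) (lrxnOn_of_lrxOn g P _ σ' hP),
      lrxnOn_mono g Q _ _ σ' (by omega) (lrxnOn_of_lrxOn g Q _ σ' hQ)⟩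

theorem lrxn_of_lrx {g : (Fin n → Bool) → Bool} {t : ℕ} {P : KWTree (Fin m × Fin n)}
    (h : LRXDisciplined g t P) : LRXNDisciplined g t P :=
  lrxnOn_of_lrxOn g P t _ h

/-- The node-count bound implies the weight bound (and hence, at budget `0`, `LRBQuantitative`). -/
theorem lrxQuantitative_of_node (h : LRXNodeQuantitative) : LRXQuantitative := by
  obtain ⟨C, hC⟩ := h
  exact ⟨C, fun m n q r ℓ t f g hf hgen hqr hsub hq hH P hP hsol =>
    hC m n q r ℓ t f g hf hgen hqr hsub hq hH P (lrxn_of_lrx hP) hsol⟩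

end NodeCount

end Summit.PneNP.PneNP.Cruxes.StrongComposition.P4g20X
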